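import Summits.FinalStateConjecture.FinalStateConjecture.Theses.BurnettKineticRigidity

/-!
# Birth skeleton (BC3) for crux `PhotonRegionThresholdCodim`
# (stmt-FinalStateConjecture-17293, route `BurnettKineticRigidity`, rank 3)

planner-skel-stmt-FinalStateConjecture-17293-0 · 2026-08-17 · skeleton-register (route re-audit bin
REPAIRABLE). Published as `Cruxes/PhotonRegionThresholdCodim/Lines/birth.lean`.

## The crux (fixed; route file rev 10, decl
`Summit.FinalStateConjecture.FinalStateConjecture.Theses.BurnettKineticRigidity.PhotonRegionThresholdCodim`)

PHOTON-REGION THRESHOLD CODIMENSION, TAME FORM: through every admissible datum `D` owning an MGHD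
`𝒟` which has complete `𝓘⁺`, carries a photon-region remnant (a late chart on a Kerr exterior
`g_{M,a}`, `0 < M`, `|a| ≤ M`, in which `Ψ^* g → g_{M,a}` in `C²` on every annular slab
`{t* = τ, ρ ≤ r ≤ R}`) and does NOT settle (summit sense), pass ONE asymptotically flat end `e`
and an injective admissible one-parameter family `F`, tame on `e` and immersed at `0`, `F 0 = D`,
all of whose members `F c`, `c ≠ 0`, are GOOD: every MGHD of `F c` has complete `𝓘⁺` and settles
whenever it carries a remnant.

## The line (the route's own TWO-LAYER PLAN for this node: "PhotonRegionThresholdCodim ⇐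
ShellEnergyTransversality → ExtremalThresholdTransversality → glue")

The threshold set splits by the spin of the remnant witness, `|a| ≤ M` ⇒ `|a| < M ∨ |a| = M`:

* `stub_shellThresholdLocalEscape` (HEART, photon-shell threshold = SUB-EXTREMAL remnant that does
  not settle): a tame immersed admissible curve through `D` whose members are good for all SMALL
  non-zero parameters `0 < ‖c‖ < ε` — local transversal crossing of the shell threshold at fixed
  asymptotics (one-parameter admissible families changing the trapped high-frequency energy,
  Corvino–Schoen / Carlotto–Schoen gluing inside the constraint class; arXiv:2102.08170,
  arXiv:1511.01290 for the shells; tameness forbids far-out burial).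
* `stub_extremalThresholdLocalEscape` (EXTREMAL threshold `|a| = M`): the same local escape
  through data whose non-settling censored MGHD carries an EXTREMAL Kerr remnant — third-law /
  Kehle–Unger one-parameter families crossing extremality transversally (KehleUnger2025,
  arXiv:2402.10190; Aretakis instability on the threshold itself).
* `stub_escapeGlobalisation` (SOFT glue, general predicate `P`): a tame immersed injective
  admissible curve through `D` whose members satisfy `P` for `0 < ‖c‖ < ε` can be reparametrised
  (`G = F ∘ φ`, `φ c = (ε/2)(1 + ‖c‖²)^{-1/2} c`: smooth, injective, `φ 0 = 0`, `dφ(0) = (ε/2)·id`,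
  `‖φ c‖ < ε`) into one whose members satisfy `P` for ALL `c ≠ 0`, keeping tameness on the same
  end (masses `M ∘ φ`, `wDist`-continuity by composition), immersion at `0` (chain rule with
  `dφ(0)` invertible), `G 0 = D`, injectivity and admissibility. Size M (ContMDiff composition on
  `ℝ¹ × X`, `fderiv` chain rule); true as stated.

`PhotonRegionThresholdCodim_of` composes them by pure logic: destructure the threshold witness,
split `|a| < M ∨ |a| = M`, take the local escape, globalise with `P := IsGood`.

Local vocabulary (`HasRemnantWith`, `HasRemnant`, `Settles`, `IsGood`, `IsTameCurveThrough`) is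
VERBATIM the corresponding sub-terms of the crux, so the composition closes the crux BY NAME up to
`δ`-unfolding. No stub restates the crux (stubs 1–2 cover one spin case each and conclude only a
LOCAL escape; stub 3 has the local escape as hypothesis) and none mentions the summit.

Disproof used: none — `ledger crux ls stmt-FinalStateConjecture-17293` shows no `Disproof.lean`
and no workfiles (2026-08-17); negatives index of the summit consulted via the route header
(far-out burial families are excluded by the TAME typing, which every stub keeps: one fixed end
`e`, `IsTameDataFamily e 1 ·`).
-/

noncomputable section

-- D-0017: single-problem summit, `Summit.<S>.<S>.…` by design.
set_option linter.dupNamespace false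

open Set Filter Function Topology TopologicalSpace
open Literature.Geometry.Lorentzian
open scoped Manifold ContDiff Topology ENNReal

namespace Summit.FinalStateConjecture.FinalStateConjecture.Cruxes.PhotonRegionThresholdCodim.Birth

/-! ## §0 Local vocabulary — verbatim sub-terms of the crux -/

section Defs

variable {X : Type} [TopologicalSpace X] [ChartedSpace Literature.Geometry.Lorentzian.E3 X]
  [IsManifold (𝓡 3) ∞ X] [T2Space X] [SecondCountableTopology X] [ConnectedSpace X]

/-- The MGHD `𝒟` **carries a photon-region remnant with parameters `(M, a)`**: a late chart `Ψ`
on the Kerr background `(M, a)` into `J⁺(ιX)` in which, for every `R`, the `C²` sup-norm of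
`Ψ^* g − g_{M,a}` on the annular slab `{t* = τ, ρ ≤ r ≤ R}` tends to `0` (the crux's remnant
clause with `M`, `a` exposed and the sign conditions on `M`, `a` removed). -/
def HasRemnantWith {D : InitialDataSet (𝓡 3) X}
    (𝒟 : Literature.Geometry.Lorentzian.VacuumCauchyDevelopment D) (M a : ℝ) : Prop :=
  ∃ (ρ τ₀ : ℝ) (Ψ : ↥(Literature.Geometry.Lorentzian.Kerr.background M a).domain → 𝒟.carrier),
    𝒟.toSpacetime.IsLateChart (Literature.Geometry.Lorentzian.Kerr.background M a)
        (𝒟.metric.causalFuture 𝒟.timeOrientation (Set.range 𝒟.embed)) τ₀ Ψ ∧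
      ∀ R : ℝ, Filter.Tendsto (fun τ : ℝ ↦ Literature.Geometry.Lorentzian.supCkENorm
        (Subtype.val '' {x : ↥(Literature.Geometry.Lorentzian.Kerr.background M a).domain |
          (x : Literature.Geometry.Lorentzian.E4) 0 = τ ∧
            ρ ≤ Literature.Geometry.Lorentzian.Kerr.radius a x ∧
              Literature.Geometry.Lorentzian.Kerr.radius a x ≤ R}) 2
        (𝒟.toSpacetime.deviationExtend (Literature.Geometry.Lorentzian.Kerr.background M a) Ψ))
        Filter.atTop (nhds 0)

/-- The MGHD `𝒟` **carries a photon-region remnant** — VERBATIM the crux's remnant clause. -/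
def HasRemnant {D : InitialDataSet (𝓡 3) X}
    (𝒟 : Literature.Geometry.Lorentzian.VacuumCauchyDevelopment D) : Prop :=
  ∃ (M a ρ τ₀ : ℝ) (Ψ : ↥(Literature.Geometry.Lorentzian.Kerr.background M a).domain → 𝒟.carrier),
    0 < M ∧ |a| ≤ M ∧
      𝒟.toSpacetime.IsLateChart (Literature.Geometry.Lorentzian.Kerr.background M a)
        (𝒟.metric.causalFuture 𝒟.timeOrientation (Set.range 𝒟.embed)) τ₀ Ψ ∧
      ∀ R : ℝ, Filter.Tendsto (fun τ : ℝ ↦ Literature.Geometry.Lorentzian.supCkENorm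
        (Subtype.val '' {x : ↥(Literature.Geometry.Lorentzian.Kerr.background M a).domain |
          (x : Literature.Geometry.Lorentzian.E4) 0 = τ ∧
            ρ ≤ Literature.Geometry.Lorentzian.Kerr.radius a x ∧
              Literature.Geometry.Lorentzian.Kerr.radius a x ≤ R}) 2
        (𝒟.toSpacetime.deviationExtend (Literature.Geometry.Lorentzian.Kerr.background M a) Ψ))
        Filter.atTop (nhds 0)

/-- The MGHD `𝒟` **settles** in the summit's (re-typed T2) sense — VERBATIM the crux's clause. -/
def Settles {D : InitialDataSet (𝓡 3) X}
    (𝒟 : Literature.Geometry.Lorentzian.VacuumCauchyDevelopment D) : Prop :=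
  ∃ (O : Set 𝒟.carrier)
    (d : Literature.Geometry.Lorentzian.FinalStateDecomposition 𝒟.toSpacetime O 2),
    (∀ i, Literature.Geometry.Lorentzian.Kerr.IsSubextremal (d.mass i) (d.spin i)) ∧
      O = Summit.FinalStateConjecture.exteriorOf 𝒟.toCauchyDevelopment d.charted ∧
        Summit.FinalStateConjecture.RaysStayInClosure 𝒟.toCauchyDevelopment O ∧
          Summit.FinalStateConjecture.HasExhaustiveCharts d ∧
            Summit.FinalStateConjecture.IsFutureOriented d

/-- The datum `D` is **good**: every MGHD of `D` has complete `𝓘⁺` and settles whenever it carries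
a remnant — VERBATIM the crux's clause on the escaping members `F c`, `c ≠ 0`. -/
def IsGood (D : InitialDataSet (𝓡 3) X) : Prop :=
  ∀ 𝒟 : Literature.Geometry.Lorentzian.VacuumCauchyDevelopment D, 𝒟.IsMaximal →
    Summit.FinalStateConjecture.HasCompleteNullInfinity 𝒟.toCauchyDevelopment ∧
      (HasRemnant 𝒟 → Settles 𝒟)

/-- `F` is a **tame immersed admissible curve through `D` on the end `e`**: tame on `e`
(`IsTameDataFamily e 1 F`), immersed at `0`, `F 0 = D`, injective, every member admissible —
VERBATIM the first five conjuncts of the crux's conclusion. -/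
def IsTameCurveThrough (D : InitialDataSet (𝓡 3) X) (e : Literature.Geometry.Lorentzian.AFEnd X)
    (F : EuclideanSpace ℝ (Fin 1) → InitialDataSet (𝓡 3) X) : Prop :=
  Literature.Geometry.Lorentzian.InitialDataSet.IsTameDataFamily e 1 F ∧
    Literature.Geometry.Lorentzian.InitialDataSet.IsImmersedAtZero 1 F ∧ F 0 = D ∧
      Function.Injective F ∧ ∀ c, F c ∈ Literature.Geometry.Lorentzian.admissibleVacuumData X

end Defs

/-! ## §1 The stub SIGNATURES

Each stub's statement is the `Prop` `Sig.stub_<name>` (a definition of this file); the registered obligation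
is `theorem stub_<name> : Sig.stub_<name> := by sorry` in §2, and the composition
`PhotonRegionThresholdCodim_of` (§3) takes the three signatures as hypotheses BY NAME (layer-invariant
skeleton audit: hypothesis heads = stub names). Obligation tags (`@[stub]`) are gate-stamped, not written
here. -/

/-- **STUB 1 — photon-shell threshold: local tame escape (HEART).** For every admissible datum
`D`, every MGHD `𝒟` of `D` with complete `𝓘⁺` carrying a SUB-EXTREMAL remnant `(M, a)`,
`0 < M`, `|a| < M`, which does not settle, there are one end `e`, a tame immersed injective
admissible curve `F` through `D` on `e` and `ε > 0` such that `F c` is good for all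
`0 < ‖c‖ < ε` (shell-energy transversality at fixed asymptotics: the shell threshold is crossed,
on both sides, into the good set). Sources: arXiv:2102.08170, arXiv:1511.01290,
Christodoulou1999 (p. A24), arXiv:2501.09730; gluing: Corvino–Schoen, Carlotto–Schoen
arXiv:1407.4766. Why it might fail: one-sidedly STABLE shells along every admissible curve at
fixed asymptotics; escaping members landing on censorship-violating or extremal-threshold data. -/
def Sig.stub_shellThresholdLocalEscape : Prop :=
    ∀ (X : Type) [TopologicalSpace X] [ChartedSpace Literature.Geometry.Lorentzian.E3 X]
      [IsManifold (𝓡 3) ∞ X] [T2Space X] [SecondCountableTopology X] [ConnectedSpace X],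
      ∀ D ∈ Literature.Geometry.Lorentzian.admissibleVacuumData X,
        ∀ 𝒟 : Literature.Geometry.Lorentzian.VacuumCauchyDevelopment D, 𝒟.IsMaximal →
          Summit.FinalStateConjecture.HasCompleteNullInfinity 𝒟.toCauchyDevelopment →
            ∀ M a : ℝ, 0 < M → |a| < M → HasRemnantWith 𝒟 M a → ¬ Settles 𝒟 →
              ∃ (e : Literature.Geometry.Lorentzian.AFEnd X)
                (F : EuclideanSpace ℝ (Fin 1) → InitialDataSet (𝓡 3) X) (ε : ℝ),
                0 < ε ∧ IsTameCurveThrough D e F ∧ ∀ c, c ≠ 0 → ‖c‖ < ε → IsGood (F c)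

/-- **STUB 2 — extremal threshold: local tame escape.** The same local escape through every
admissible datum owning a non-settling MGHD with complete `𝓘⁺` that carries an EXTREMAL remnant
`(M, a)`, `0 < M`, `|a| = M` (third-law transversality: Kehle–Unger-type admissible families cross
extremality transversally at fixed asymptotics, sub-extremal on one side, and the other side is
good as well). Sources: KehleUnger2025, arXiv:2402.10190, Aretakis2015,
doi:10.1007/s10714-025-03394-1 (§6.4: the fractional-codimension caveat). Why it might fail: a
chaotic extremal-forming residue of empty interior met by every tame curve near `D`
(Dafermos 2025 §6.4), i.e. no `ε`-interval of good members on any curve. -/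
def Sig.stub_extremalThresholdLocalEscape : Prop :=
    ∀ (X : Type) [TopologicalSpace X] [ChartedSpace Literature.Geometry.Lorentzian.E3 X]
      [IsManifold (𝓡 3) ∞ X] [T2Space X] [SecondCountableTopology X] [ConnectedSpace X],
      ∀ D ∈ Literature.Geometry.Lorentzian.admissibleVacuumData X,
        ∀ 𝒟 : Literature.Geometry.Lorentzian.VacuumCauchyDevelopment D, 𝒟.IsMaximal →
          Summit.FinalStateConjecture.HasCompleteNullInfinity 𝒟.toCauchyDevelopment →
            ∀ M a : ℝ, 0 < M → |a| = M → HasRemnantWith 𝒟 M a → ¬ Settles 𝒟 →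
              ∃ (e : Literature.Geometry.Lorentzian.AFEnd X)
                (F : EuclideanSpace ℝ (Fin 1) → InitialDataSet (𝓡 3) X) (ε : ℝ),
                0 < ε ∧ IsTameCurveThrough D e F ∧ ∀ c, c ≠ 0 → ‖c‖ < ε → IsGood (F c)

/-- **STUB 3 — globalisation of a local tame escape (soft glue; general predicate `P`).** A tame
immersed injective admissible curve `F` through `D` on `e` whose members satisfy `P` for
`0 < ‖c‖ < ε` yields one, `G`, on the SAME end whose members satisfy `P` for ALL `c ≠ 0`:
`G := F ∘ φ` with `φ c = (ε/2)(1 + ‖c‖²)^{-1/2} c` (smooth injective self-map of `ℝ¹` onto the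
`ε/2`-ball, `φ 0 = 0`, `dφ(0) = (ε/2)·id`). Tameness: `IsSmoothDataFamily` by ContMDiff
composition with `(c, x) ↦ (φ c, x)`, masses `M ∘ φ`, `wDist`-continuity at `0` by `Tendsto.comp`;
immersion at `0`: chain rule (`fderiv (f ∘ φ) 0 v = (ε/2) fderiv f 0 v`, `f` differentiable at `0`
because its `fderiv` there is non-zero); `G 0 = F 0 = D`; injectivity and admissibility are
inherited. Size M. Sources: Christodoulou1999 (p. A24: lines in the fixed space `𝓐`),
DafermosRodnianski2008 (App. B.2.3). Why it might fail: it does not (pure reparametrisation); the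
only traps are the junk-value conventions of `fderiv` (handled as described). -/
def Sig.stub_escapeGlobalisation : Prop :=
    ∀ (X : Type) [TopologicalSpace X] [ChartedSpace Literature.Geometry.Lorentzian.E3 X]
      [IsManifold (𝓡 3) ∞ X] (P : InitialDataSet (𝓡 3) X → Prop) (D : InitialDataSet (𝓡 3) X)
      (e : Literature.Geometry.Lorentzian.AFEnd X)
      (F : EuclideanSpace ℝ (Fin 1) → InitialDataSet (𝓡 3) X) (ε : ℝ),
      0 < ε → IsTameCurveThrough D e F → (∀ c, c ≠ 0 → ‖c‖ < ε → P (F c)) →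
        ∃ G : EuclideanSpace ℝ (Fin 1) → InitialDataSet (𝓡 3) X,
          IsTameCurveThrough D e G ∧ ∀ c, c ≠ 0 → P (G c)

/-! ## §2 The registered stubs (the ONLY sorries of this file) -/

/-- STUB 1 (heart): sub-extremal (photon-shell) threshold — local tame escape. See `Sig.stub_shellThresholdLocalEscape`. -/
theorem stub_shellThresholdLocalEscape : Sig.stub_shellThresholdLocalEscape := by
  sorry

/-- STUB 2: extremal threshold — local tame escape. See `Sig.stub_extremalThresholdLocalEscape`. -/
theorem stub_extremalThresholdLocalEscape : Sig.stub_extremalThresholdLocalEscape := by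
  sorry

/-- STUB 3 (soft glue): globalisation of a local tame escape by reparametrisation. See
`Sig.stub_escapeGlobalisation`. -/
theorem stub_escapeGlobalisation : Sig.stub_escapeGlobalisation := by
  sorry

/-! ## §3 The composition (pure logic, sorry-free): the stubs close the crux BY NAME -/

/-- **`PhotonRegionThresholdCodim` from the three stubs.** Destructure the threshold witness
`⟨𝒟, maximal, complete, ⟨M, a, ρ, τ₀, Ψ, 0 < M, |a| ≤ M, late chart, annular convergence⟩,
¬ settles⟩`; split `|a| < M ∨ |a| = M` (`le_iff_lt_or_eq`); stubs 1/2 give a LOCAL tame escape into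
the good set; stub 3 (with `P := IsGood`) globalises it on the same end; the result is the crux's
conclusion up to `δ`-unfolding of the local vocabulary (`IsGood`, `HasRemnant`, `Settles` are the
crux's own sub-terms). -/
theorem PhotonRegionThresholdCodim_of :
    Sig.stub_shellThresholdLocalEscape → Sig.stub_extremalThresholdLocalEscape →
      Sig.stub_escapeGlobalisation →
        Summit.FinalStateConjecture.FinalStateConjecture.Theses.BurnettKineticRigidity.PhotonRegionThresholdCodim := by
  intro hShell hExt hGlob X _ _ _ _ _ _ D hD hthr
  obtain ⟨𝒟, hmax, hcomp, ⟨M, a, ρ, τ₀, Ψ, hM, ha, hlate, hconv⟩, hns⟩ := hthr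
  have hrem : HasRemnantWith 𝒟 M a := ⟨ρ, τ₀, Ψ, hlate, hconv⟩
  have hns' : ¬ Settles 𝒟 := hns
  -- local escape, by cases on the spin of the remnant witness
  have hloc : ∃ (e : Literature.Geometry.Lorentzian.AFEnd X)
      (F : EuclideanSpace ℝ (Fin 1) → InitialDataSet (𝓡 3) X) (ε : ℝ),
      0 < ε ∧ IsTameCurveThrough D e F ∧ ∀ c, c ≠ 0 → ‖c‖ < ε → IsGood (F c) := by
    rcases ha.lt_or_eq with hlt | heq
    · exact hShell X D hD 𝒟 hmax hcomp M a hM hlt hrem hns'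
    · exact hExt X D hD 𝒟 hmax hcomp M a hM heq hrem hns'
  obtain ⟨e, F, ε, hε, hF, hFgood⟩ := hloc
  -- globalise on the same end, with the crux's goodness predicate
  obtain ⟨G, ⟨hGt, hGi, hG0, hGinj, hGadm⟩, hGgood⟩ := hGlob X IsGood D e F ε hε hF hFgood
  refine ⟨e, G, hGt, hGi, hG0, hGinj, hGadm, fun c hc 𝒟' h𝒟' ↦ ?_⟩
  exact hGgood c hc 𝒟' h𝒟'

/-- The skeleton instantiated: the crux modulo the three registered stubs (its axiom closure
contains `sorryAx` exactly through `stub_*`). -/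
theorem PhotonRegionThresholdCodim_skeleton :
    Summit.FinalStateConjecture.FinalStateConjecture.Theses.BurnettKineticRigidity.PhotonRegionThresholdCodim :=
  PhotonRegionThresholdCodim_of stub_shellThresholdLocalEscape stub_extremalThresholdLocalEscape
    stub_escapeGlobalisation

end Summit.FinalStateConjecture.FinalStateConjecture.Cruxes.PhotonRegionThresholdCodim.Birth

end
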